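import Summits.BirchSwinnertonDyer.Rank1Residual.X11b.Three.FramedImageRestrict
import Summits.BirchSwinnertonDyer.Rank1Residual.X11b.Three.ImageSpan
import Summits.BirchSwinnertonDyer.Rank1Residual.X11b.Three.MoritaDuality
import HarnessLib

/-!
# X11b at `p = 3` (team N8/O2), E-K8 · IMG3-GEN in the `Γ_K`-currency (2/2): Galois-stable ⇒
# End-stable and the U2 core when `ρ̄_{E,p}` is onto ON A SUBGROUP — `ρ̄_{E,p} ∘ φ` onto for a
# homomorphism `φ : G → Γ_F`, e.g. `φ = absGaloisRestrict ℚ K : Γ_K → Γ_ℚ` (cell `b2b-bsdres`,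
# team `x11b3`, seat p2)

HONEST FRAMING (verbatim, cell `b2b-bsdres`, run/shared/lean/b2b/bsd-rank1-residual/): the goal of
the cell is to DELETE the COMBINATION-SHAPED residual classes for ALL analytic-rank `≤ 1` curves
over `ℚ` — "full BSD formula for every rank `≤ 1` curve in class `C`" assembled STRICTLY from
published theorems — so that the rank-`≤ 1` remainder becomes exactly the CONSTRUCTION-SHAPED
classes, which are TYPED (missing-input Props), NOT attempted; this is not "finishing BSD".
Research route (team N8/O2: STEP L at `3 ‖ N`, LINE K); ELEMENTARY Galois-module algebra; nothing
booked; no label touched; X11b@3 stays OPEN (RESIDUAL-MAP §I O2). THEOREMS ONLY; no definition;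
no named fact; no `sorry`.

## What (the three curve-level E-K8 statements of `Three/GaloisImageSpansEnd` and
## `Three/GaloisStableHomEqTop`, with `Γ_F` replaced by any `G →* Γ_F` on which `ρ̄_{E,p}` is onto)

For `W` elliptic over a field `F` with `(p : F) ≠ 0`, `T = E[p^{k+1}]`, `φ : G →* Γ_F` with
`(galoisRepTorsion W p).comp φ` surjective (for `F = ℚ`, `G = Γ_K`, `φ = absGaloisRestrict ℚ K`
this is EXACTLY the conclusion of `Three.surjective_galoisRepTorsion_comp_absGaloisRestrict_of_classX11b`,
x11b3-p1's S6 record `Three/ImageAtThreeField`, at `p = 3` on X11b ∧ Surj with a Heegner field `K`):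
* `WeierstrassCurve.comp_mem_of_forall_comp_mem_of_surjective_comp` — an additive subgroup
  `V ≤ Hom(C, T)` stable under `f ↦ (φ g • ·) ∘ f` (`g ∈ G`) is stable under `f ↦ ψ ∘ f` for
  EVERY additive endomorphism `ψ` of `T`;
* `WeierstrassCurve.map_mem_of_forall_smul_mem_of_surjective_comp` — a `φ(G)`-stable additive
  subgroup of `T` is End-stable;
* `WeierstrassCurve.addSubgroup_hom_geomTorsion_eq_top_of_surjective_comp` — **U2 core over `K`**:
  `C` finite with `p^{k+1} C = 0`, `V ≤ Hom(C, T)` `φ(G)`-stable and detecting every `c ≠ 0`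
  ⟹ `V = Hom(C, T)`.
Proofs: those of the `Γ_F` versions verbatim, with the frame bookkeeping
`WeierstrassCurve.exists_map_comp_eq_of_surjective_comp` (`Three/FramedImageRestrict`) in place of
`exists_map_eq_of_hasSurjectiveModNGaloisRep`.

Dictionary (McCallum §3 (2) at `p = 3`): `F = ℚ`, `G = Γ_K`, `K` the Heegner field, `V` = image of
`Gal(L_C/L)` in `Hom(C, E[3^M])` (`L = K(E[3^M])`, `C ≤ H¹(K, E[3^M])` finite), detection from U1
(Sah, tree `Three/GaloisImageNegOne`). What this file is NOT: no Galois cohomology; no claim about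
any class; nothing booked.

References: W. G. McCallum, LMS LNS 153 (1991) §3 [McCallum1991]; J.-P. Serre, Invent. Math. 15
(1972) §IV [Serre1972]; S. Lang, *Algebra* XVII §1 [Lang2002]; J. S. Milne, *Arithmetic Duality
Theorems* I (0.19) [MilneADT2006]; team files `cells/x11b3/LINE-K.md` block 3 (U2).
-/

namespace WeierstrassCurve

open Summit.BirchSwinnertonDyer.Rank1Residual.X11b.Three Literature.NumberTheory.EllipticCurves
open Matrix

universe u

variable {F : Type u} [Field F] (W : WeierstrassCurve F) [W.IsElliptic]

/-- **Galois-stable ⇒ End-stable, restricted currency.** `ρ̄_{E,p} ∘ φ` onto (`φ : G →* Γ_F`),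
`T = E[p^{k+1}]`: an additive subgroup `V ≤ Hom(C, T)` stable under `f ↦ (φ g • ·) ∘ f` for all
`g ∈ G` is stable under post-composition by EVERY additive endomorphism of `T`. EVERY prime `p`,
every field with `(p : F) ≠ 0`. [folklore] -/
theorem comp_mem_of_forall_comp_mem_of_surjective_comp (p k : ℕ) [Fact p.Prime]
    (hpF : (p : F) ≠ 0) {G : Type*} [Group G] (φ : G →* Field.absoluteGaloisGroup F)
    (hsurj : Function.Surjective ((galoisRepTorsion W (p : ℤ)).comp φ))
    {C : Type*} [AddCommGroup C]
    (V : AddSubgroup (C →+ W.geomTorsion ((p ^ (k + 1) : ℕ) : ℤ)))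
    (hV : ∀ g : G, ∀ f ∈ V,
      (DistribSMul.toAddMonoidHom (W.geomTorsion ((p ^ (k + 1) : ℕ) : ℤ)) (φ g)).comp f ∈ V)
    (ψ : W.geomTorsion ((p ^ (k + 1) : ℕ) : ℤ) →+ W.geomTorsion ((p ^ (k + 1) : ℕ) : ℤ))
    (f : C →+ W.geomTorsion ((p ^ (k + 1) : ℕ) : ℤ)) (hf : f ∈ V) : ψ.comp f ∈ V := by
  have hp : p.Prime := Fact.out
  haveI : NeZero (p ^ (k + 1)) := ⟨pow_ne_zero _ hp.ne_zero⟩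
  -- a frame, its matrix representation, and its full image mod `p`
  obtain ⟨e⟩ := nonempty_addEquiv_geomTorsion W p (k + 1) (Nat.succ_le_succ (Nat.zero_le k)) hpF
  obtain ⟨ρ, hρ⟩ := exists_rep_of_addEquiv W e
  have hfull := W.exists_map_comp_eq_of_surjective_comp p k hpF e ρ hρ φ hsurj
  have hspan := ImageSpan.span_eq_top_of_forall_exists_map_eq
    (Set.range fun g : G =>
      (ρ (φ g) : Matrix (Fin 2) (Fin 2) (ZMod (p ^ (k + 1)))))
    (fun t => by obtain ⟨g, hg⟩ := hfull t; exact ⟨ρ (φ g), ⟨g, rfl⟩, hg⟩)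
  -- the endomorphism attached to a matrix `B` through the frame, `x ↦ e⁻¹ (B *ᵥ e x)`, composed
  -- with `f`; its value at `c`
  have happly : ∀ (B : Matrix (Fin 2) (Fin 2) (ZMod (p ^ (k + 1)))) (c : C),
      (e.symm.toAddMonoidHom.comp ((Matrix.mulVecLin B).toAddMonoidHom.comp
        (e.toAddMonoidHom.comp f))) c = e.symm (B *ᵥ e (f c)) := fun B c => rfl
  -- every matrix in the `ℤ`-span of the `ρ σ` gives an element of `V`
  have key : ∀ B ∈ Submodule.span ℤ
      (Set.range fun g : G =>
        (ρ (φ g) : Matrix (Fin 2) (Fin 2) (ZMod (p ^ (k + 1))))),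
      (e.symm.toAddMonoidHom.comp ((Matrix.mulVecLin B).toAddMonoidHom.comp
        (e.toAddMonoidHom.comp f))) ∈ V := by
    intro B hB
    induction hB using Submodule.span_induction with
    | mem B hB =>
      obtain ⟨g, rfl⟩ := hB
      have hmem := hV g f hf
      convert hmem using 1
      refine AddMonoidHom.ext fun c => ?_
      rw [happly, ← hρ (φ g) (f c), AddEquiv.symm_apply_apply]
      rfl
    | zero =>
      convert V.zero_mem using 1
      refine AddMonoidHom.ext fun c => ?_
      rw [happly, Matrix.zero_mulVec, map_zero, AddMonoidHom.zero_apply]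
    | add B B' _ _ hB hB' =>
      convert V.add_mem hB hB' using 1
      refine AddMonoidHom.ext fun c => ?_
      rw [AddMonoidHom.add_apply, happly, happly, happly, Matrix.add_mulVec, map_add]
    | smul n B _ hB =>
      convert V.zsmul_mem hB n using 1
      refine AddMonoidHom.ext fun c => ?_
      rw [AddMonoidHom.zsmul_apply, happly, happly, Matrix.smul_mulVec, map_zsmul]
  -- the matrix of `e ∘ φ ∘ e⁻¹` lies in that span (`ImageSpan`: the `ρ σ` span everything)
  let φ' : (Fin 2 → ZMod (p ^ (k + 1))) →ₗ[ZMod (p ^ (k + 1))] (Fin 2 → ZMod (p ^ (k + 1))) :=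
    (e.toAddMonoidHom.comp (ψ.comp e.symm.toAddMonoidHom)).toZModLinearMap (p ^ (k + 1))
  have hA : ∀ x, e (ψ x) = LinearMap.toMatrix' φ' *ᵥ e x := by
    intro x
    rw [← Matrix.toLin'_apply, Matrix.toLin'_toMatrix']
    change e (ψ x) = e (ψ (e.symm (e x)))
    rw [AddEquiv.symm_apply_apply]
  have hAZ : LinearMap.toMatrix' φ' ∈ Submodule.span ℤ
      (Set.range fun g : G =>
        (ρ (φ g) : Matrix (Fin 2) (Fin 2) (ZMod (p ^ (k + 1))))) := by
    rw [← Submodule.restrictScalars_span ℤ (ZMod (p ^ (k + 1)))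
      (ZMod.ringHom_surjective (algebraMap ℤ (ZMod (p ^ (k + 1))))) _,
      Submodule.restrictScalars_mem, hspan]
    exact Submodule.mem_top
  have hmem := key (LinearMap.toMatrix' φ') hAZ
  convert hmem using 1
  refine AddMonoidHom.ext fun c => ?_
  rw [happly, ← hA, AddEquiv.symm_apply_apply]
  rfl

/-- **`φ(G)`-stable subgroups of `E[p^{k+1}]` are End-stable** when `ρ̄_{E,p} ∘ φ` is onto.
[folklore] -/
theorem map_mem_of_forall_smul_mem_of_surjective_comp (p k : ℕ) [Fact p.Prime]
    (hpF : (p : F) ≠ 0) {G : Type*} [Group G] (φ : G →* Field.absoluteGaloisGroup F)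
    (hsurj : Function.Surjective ((galoisRepTorsion W (p : ℤ)).comp φ))
    (H : AddSubgroup (W.geomTorsion ((p ^ (k + 1) : ℕ) : ℤ)))
    (hH : ∀ g : G, ∀ x ∈ H, φ g • x ∈ H)
    (ψ : W.geomTorsion ((p ^ (k + 1) : ℕ) : ℤ) →+ W.geomTorsion ((p ^ (k + 1) : ℕ) : ℤ))
    (x : W.geomTorsion ((p ^ (k + 1) : ℕ) : ℤ)) (hx : x ∈ H) : ψ x ∈ H := by
  -- apply the `Hom` form with `C = ℤ`, `V = {f | f 1 ∈ H}` and `f = (n ↦ n • x)`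
  let V : AddSubgroup (ℤ →+ W.geomTorsion ((p ^ (k + 1) : ℕ) : ℤ)) :=
    { carrier := {f | f 1 ∈ H}
      add_mem' := fun {f g} hf hg => by
        change f 1 + g 1 ∈ H
        exact H.add_mem hf hg
      zero_mem' := H.zero_mem
      neg_mem' := fun {f} hf => by
        change -(f 1) ∈ H
        exact H.neg_mem hf }
  have hV : ∀ g : G, ∀ f ∈ V,
      (DistribSMul.toAddMonoidHom (W.geomTorsion ((p ^ (k + 1) : ℕ) : ℤ)) (φ g)).comp f ∈ V :=
    fun g f hf => hH g (f 1) hf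
  have hx' : zmultiplesHom (W.geomTorsion ((p ^ (k + 1) : ℕ) : ℤ)) x ∈ V := by
    change zmultiplesHom (W.geomTorsion ((p ^ (k + 1) : ℕ) : ℤ)) x 1 ∈ H
    rwa [zmultiplesHom_apply, one_zsmul]
  have h := W.comp_mem_of_forall_comp_mem_of_surjective_comp p k hpF φ hsurj V hV ψ _ hx'
  change ψ (zmultiplesHom (W.geomTorsion ((p ^ (k + 1) : ℕ) : ℤ)) x 1) ∈ H at h
  rwa [zmultiplesHom_apply, one_zsmul] at h

/-- **McCallum §3 (2), algebraic core (U2), restricted currency.** `ρ̄_{E,p} ∘ φ` onto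
(`φ : G →* Γ_F`; e.g. `Γ_K → Γ_ℚ`), `C` a finite abelian group killed by `p^{k+1}`,
`V ≤ Hom(C, E[p^{k+1}])` an additive subgroup stable under `f ↦ (φ g • ·) ∘ f` and detecting every
non-zero `c` (`∃ f ∈ V, f c ≠ 0`) ⟹ `V = Hom(C, E[p^{k+1}])`. EVERY prime `p`, every level.
[folklore] -/
theorem addSubgroup_hom_geomTorsion_eq_top_of_surjective_comp (p k : ℕ) [Fact p.Prime]
    (hpF : (p : F) ≠ 0) {G : Type*} [Group G] (φ : G →* Field.absoluteGaloisGroup F)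
    (hsurj : Function.Surjective ((galoisRepTorsion W (p : ℤ)).comp φ))
    {C : Type*} [AddCommGroup C] [Finite C]
    (hC : ∀ c : C, (p ^ (k + 1)) • c = 0)
    (V : AddSubgroup (C →+ W.geomTorsion ((p ^ (k + 1) : ℕ) : ℤ)))
    (hV : ∀ g : G, ∀ f ∈ V,
      (DistribSMul.toAddMonoidHom (W.geomTorsion ((p ^ (k + 1) : ℕ) : ℤ)) (φ g)).comp f ∈ V)
    (hdet : ∀ c : C, c ≠ 0 → ∃ f ∈ V, f c ≠ 0) : V = ⊤ := by
  have hp : p.Prime := Fact.out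
  haveI : NeZero (p ^ (k + 1)) := ⟨pow_ne_zero _ hp.ne_zero⟩
  -- notation: `T = E[p^{k+1}]`, `R = ℤ/p^{k+1}`, a frame `e`, coordinates `π j`, embeddings `ι i`
  obtain ⟨e⟩ := nonempty_addEquiv_geomTorsion W p (k + 1) (Nat.succ_le_succ (Nat.zero_le k)) hpF
  have hEnd := W.comp_mem_of_forall_comp_mem_of_surjective_comp p k hpF φ hsurj V hV
  let π : Fin 2 → (W.geomTorsion ((p ^ (k + 1) : ℕ) : ℤ) →+ ZMod (p ^ (k + 1))) := fun j =>
    (Pi.evalAddMonoidHom (fun _ : Fin 2 => ZMod (p ^ (k + 1))) j).comp e.toAddMonoidHom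
  let ι : Fin 2 → (ZMod (p ^ (k + 1)) →+ W.geomTorsion ((p ^ (k + 1) : ℕ) : ℤ)) := fun i =>
    e.symm.toAddMonoidHom.comp (AddMonoidHom.single (fun _ : Fin 2 => ZMod (p ^ (k + 1))) i)
  have hπ : ∀ j x, π j x = e x j := fun j x => rfl
  have hι : ∀ i r, ι i r = e.symm (Pi.single i r) := fun i r => rfl
  have hπι : ∀ r, π 0 (ι 0 r) = r := fun r => by
    rw [hπ, hι, AddEquiv.apply_symm_apply, Pi.single_eq_same]
  -- `Y = {g | ι₀ ∘ g ∈ V}`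
  let Y : AddSubgroup (C →+ ZMod (p ^ (k + 1))) :=
    { carrier := {g | (ι 0).comp g ∈ V}
      add_mem' := fun {g h} hg hh => by
        change (ι 0).comp (g + h) ∈ V
        rw [AddMonoidHom.comp_add]
        exact V.add_mem hg hh
      zero_mem' := by
        change (ι 0).comp 0 ∈ V
        rw [AddMonoidHom.comp_zero]
        exact V.zero_mem
      neg_mem' := fun {g} hg => by
        change (ι 0).comp (-g) ∈ V
        rw [AddMonoidHom.comp_neg]
        exact V.neg_mem hg }
  -- `π_j ∘ f ∈ Y` for `f ∈ V` (End-stability with `φ = ι₀ ∘ π_j`)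
  have hπY : ∀ j, ∀ f ∈ V, (π j).comp f ∈ Y := fun j f hf => by
    change (ι 0).comp ((π j).comp f) ∈ V
    rw [← AddMonoidHom.comp_assoc]
    exact hEnd ((ι 0).comp (π j)) f hf
  -- `Y` detects every `c ≠ 0`, hence `Y = ⊤`
  have hY : Y = ⊤ := by
    refine Duality.eq_top_of_forall_exists_apply_ne_zero hC Y fun c hc => ?_
    obtain ⟨f, hf, hfc⟩ := hdet c hc
    have hefc : e (f c) ≠ 0 := fun h0 => hfc (e.map_eq_zero_iff.mp h0)
    obtain ⟨j, hj⟩ := Function.ne_iff.mp hefc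
    exact ⟨(π j).comp f, hπY j f hf, by rwa [AddMonoidHom.comp_apply, hπ]⟩
  -- every `g` is `ι₀ ∘ (π₀ ∘ g) + (ι₁ ∘ π₀) ∘ (ι₀ ∘ (π₁ ∘ g))`
  rw [eq_top_iff]
  rintro g -
  have h0 : (ι 0).comp ((π 0).comp g) ∈ V := by
    have : (π 0).comp g ∈ Y := by rw [hY]; exact AddSubgroup.mem_top _
    exact this
  have h1 : ((ι 1).comp (π 0)).comp ((ι 0).comp ((π 1).comp g)) ∈ V := by
    have : (π 1).comp g ∈ Y := by rw [hY]; exact AddSubgroup.mem_top _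
    exact hEnd ((ι 1).comp (π 0)) _ this
  have hg : g = (ι 0).comp ((π 0).comp g) + ((ι 1).comp (π 0)).comp ((ι 0).comp ((π 1).comp g)) := by
    refine AddMonoidHom.ext fun c => ?_
    simp only [AddMonoidHom.add_apply, AddMonoidHom.comp_apply, hπι]
    rw [hι, hι, ← map_add, hπ, hπ]
    apply e.injective
    rw [AddEquiv.apply_symm_apply]
    ext i
    fin_cases i <;> simp
  rw [hg]
  exact V.add_mem h0 h1

end WeierstrassCurve
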